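import Mathlib
import Summits.Ventures.PercRepro2.CoinTreeCore
import Summits.Ventures.PercRepro2.CoinOrTailKDefs
import Summits.Ventures.PercRepro2.CoinChainBlindGenDarc

/-!
# The GENERAL AND-switch chain with a head-blind non-entry marker: an instantiation
(blind cell PercRepro2, night-2 g20; NIGHT2-DARC.md §60.8)

Nineteen coins on `Fin 12` (s = 0, m₁ = 1, e₁ = 2, m₂ = 3, f = 4, a' = 5, a = 6, h₁ = 7, h₂ = 8,
h₃ = 9, w = 10, t = 11): the out-tree core `s → m₁, e₁, m₂, f`; the OR-vertex `a'` entered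
from `e₁, m₂` by sure arcs; the free-arc vertex `a` entered from `a'` by one coin AND from the
core vertex `f` by a sure arc (the general chain: `a` has the sure entry `f` and the coin entry
`a'`); the head `a → h₁ ← e₁`, `a → h₂ ← m₂`, `f → h₂`, `w → h₃ ← m₂`, `a → h₃`, `h_i → t`.  The
marker `m₁` is a NON-ENTRY with no out-arcs (head-blind); the marker `m₂` is an entry of `a'`.
Row 2′DARC at `a → w` for the markers `(m₁, m₂)` for EVERY probability vector with the three
sure arcs sure (`darc_gen_blind_example`).
-/

namespace Summit.Ventures.PercRepro2.Coin

namespace GenBlindExample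

open Classical

/-- The nineteen coins of the example. -/
def arcsGB : Fin 19 → Finset (Fin 12 × Fin 12)
  | 0 => {(0, 1)}    -- s → m₁
  | 1 => {(0, 2)}    -- s → e₁
  | 2 => {(0, 3)}    -- s → m₂
  | 3 => {(0, 4)}    -- s → f
  | 4 => {(2, 5)}    -- e₁ → a' (sure)
  | 5 => {(3, 5)}    -- m₂ → a' (sure)
  | 6 => {(5, 6)}    -- a' → a (the chain coin)
  | 7 => {(4, 6)}    -- f → a (sure: the sure entry of a)
  | 8 => {(6, 7)}    -- a → h₁
  | 9 => {(2, 7)}    -- e₁ → h₁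
  | 10 => {(7, 11)}  -- h₁ → t
  | 11 => {(6, 8)}   -- a → h₂
  | 12 => {(3, 8)}   -- m₂ → h₂
  | 13 => {(4, 8)}   -- f → h₂
  | 14 => {(8, 11)}  -- h₂ → t
  | 15 => {(10, 9)}  -- w → h₃
  | 16 => {(3, 9)}   -- m₂ → h₃
  | 17 => {(9, 11)}  -- h₃ → t
  | _ => {(6, 9)}    -- a → h₃

/-- The entry coins of `a'`. -/
def c'GB : Fin 12 → Fin 19
  | 2 => 4
  | 3 => 5
  | _ => 0

/-- The entry coins of `a` (from `a'` and from `f`). -/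
def cGB : Fin 12 → Fin 19
  | 5 => 6
  | 4 => 7
  | _ => 0

/-- The tree coins. -/
def tcGB : Fin 12 → Fin 19
  | 1 => 0
  | 2 => 1
  | 3 => 2
  | 4 => 3
  | _ => 0

/-- The parent map (the root `s`). -/
def parGB : Fin 12 → Fin 12 := fun _ => 0

/-- The rank. -/
def rkGB : Fin 12 → ℕ
  | 1 => 1
  | 2 => 1
  | 3 => 1
  | 4 => 1
  | _ => 0

/-- Every coin is a single arc. -/
lemma sameEnds_gb : SameEnds arcsGB := by
  intro e xy hxy x'y' hx'y'
  fin_cases e <;> simp [arcsGB] at hxy hx'y' <;> subst hxy <;> subst hx'y' <;>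
    exact ⟨Or.inl rfl, Or.inr rfl⟩

set_option maxRecDepth 20000 in
/-- The out-tree core `{m₁, e₁, m₂, f}`. -/
lemma treeCore_gb : TreeCore arcsGB 0 {1, 2, 3, 4} tcGB parGB rkGB where
  tree := by decide
  par_mem := by decide
  rank := by decide
  into_C := by decide
  into_s := by decide
  s_notin := by decide

set_option maxRecDepth 20000 in
/-- `a' = 5` is an OR-vertex of the core entered from `e₁, m₂`. -/
lemma orTailK'_gb : OrTailK arcsGB 0 {1, 2, 3, 4} {2, 3} c'GB 5 where
  ent_sub := by decide
  s_notin := by decide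
  a_notin := by decide
  a_ne_s := by decide
  into_U := by decide
  into_s := by decide
  into_a := by decide
  arcs_c := by decide
  c_inj := by decide

set_option maxRecDepth 20000 in
/-- `a = 6` is an OR-vertex of `U ∪ {a'}` entered from `a'` and `f`. -/
lemma orTailK_gb : OrTailK arcsGB 0 (insert 5 {1, 2, 3, 4}) (insert 5 {4}) cGB 6 where
  ent_sub := by decide
  s_notin := by decide
  a_notin := by decide
  a_ne_s := by decide
  into_U := by decide
  into_s := by decide
  into_a := by decide
  arcs_c := by decide
  c_inj := by decide

set_option maxRecDepth 20000 in
/-- **Row 2′DARC at `a → w` for the markers `(m₁, m₂)` on the nineteen-coin general chain, every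
probability vector with the three sure arcs sure** — the non-entry marker `m₁` is head-blind. -/
theorem darc_gen_blind_example {R : Type*} [Field R] [LinearOrder R] [IsStrictOrderedRing R]
    (pr : Fin 19 → R) (hp : IsProbVec pr) (h4 : pr 4 = 1) (h5 : pr 5 = 1) (h7 : pr 7 = 1) :
    DARC pr arcsGB 0 {11} 1 3 6 10 :=
  darc_of_chainTree_of_blind pr hp sameEnds_gb orTailK'_gb
    (by
      intro r hr
      simp only [Finset.mem_insert, Finset.mem_singleton] at hr
      rcases hr with rfl | rfl
      · exact h4
      · exact h5)
    orTailK_gb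
    (by
      intro r hr
      simp only [Finset.mem_singleton] at hr
      subst hr; exact h7)
    (by decide) treeCore_gb (by decide) (by decide) (by decide) (by decide) (by decide) (by decide)
    (by decide)

end GenBlindExample

end Summit.Ventures.PercRepro2.Coin
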